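import Summits.AnomalousDissipation.AnomalousDissipation.Theorems.SolenoidalFractalHomogenisationLagrangianStepSidebandXGenFrame
import Summits.AnomalousDissipation.AnomalousDissipation.Theorems.SolenoidalFractalHomogenisationLagrangianStepCellChainClassicalFrame
import Summits.AnomalousDissipation.AnomalousDissipation.Theorems.SolenoidalFractalHomogenisationLagrangianStepSidebandXChain
import HarnessLib

/-!
# K1L_D `LagrangianRenormalisationStepDesign` (stmt-AnomalousDissipation-27980), registered stub `stub_D1_V0thg` (v28, ruling D28-3 (3)), port-map layer L5:
# THE BOX-TRUNCATED CHAIN OF THE FROZEN-FRAME WEAK SOLUTION AS A CLASSICAL ODE IN `Space R` —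
# `Z' = genXθ·Z + Σⱼ ξⱼ·sourceXθⱼ·x + tail`, `x' = −4π²P^θ T^θ x − Σⱼ ξⱼ·P^θ_ℓ feedbackⱼ·Z` (helper; `--supports stmt-AnomalousDissipation-27980 --as helper`)

Summits-side helper file of route `SolenoidalFractalHomogenisation` (prover seat `ad-k1l-cellLawV-w1` g9; port map
`Cruxes/LagrangianRenormalisationStepDesign/Lines/onelevel-vtheta-twist-portmap.md` §3 L5, ruling D28-7).  The frozen-frame twin of `…SidebandXChain` for
`h : Torus.IsWeakTensorPassiveVectorDistortedOn 0 T 𝔹 (W₁.cell n) (fun _ _ => G₀) F u` and the objects of `…SidebandXDefsFrame` / `…CellChainDefsFrame`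
(`sbVecθ`, `genXθ`, `sourceXθ`, `tailVecθ`, `modeRepθ`; `feedback`, `xiCoeff`, `classFreq`, `space_sum_apply`, `link_split_identity`, `rhs_assemble_identity` are flat,
REUSED BY NAME).  Everything proved; no definitions, no named facts, no sorry.
* `transversalProjR_modeRepθ` — `P^θ_k (modeRepθ k t) = modeRepθ k t` on `[0,T]` (`rdot_modeRepθ`);
* `neighbour_split_frame`, **`repRHSθ_classFreq_eq`** — the representative right-hand side at `k_z` IS `(genXθ Z + Σⱼ ξⱼ • sourceXθⱼ x + tailVecθ)_z`;
* **`hasDerivAt_sbVecθ`** — on `(0,T)`, `HasDerivAt (sbVecθ … ℓ R) (genXθ t Z + Σⱼ ξⱼ • sourceXθⱼ t x + tailVecθ t) t`;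
* **`hasDerivAt_slowRepθ`** — on `(0,T)`, if every `±mⱼ` is retained, `HasDerivAt (modeRepθ … ℓ) (−4π² P^θ_ℓ T_{(𝔹^{G₀})ᵀ}(ℓ) x − Σⱼ ξⱼ • P^θ_ℓ (feedbackⱼ t Z)) t`.
At `G₀ = 1` these are literally the flat statements.
NOT a proof of any registered stub, of the crux, or of anomalous dissipation; rung F-D1 infrastructure for the `stub_D1_V0thg` engine.
-/

set_option linter.dupNamespace false

noncomputable section

namespace Summit.AnomalousDissipation.AnomalousDissipation.Theorems.SolenoidalFractalHomogenisation.LagrangianStep.Sideband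

open Set MeasureTheory Complex UnitAddTorus
open scoped InnerProductSpace
open Literature.Analysis Literature.Analysis.FunctionSpaces Literature.Analysis.FunctionSpaces.Torus
open Literature.Analysis.FluidPDE Literature.Analysis.FluidPDE.Torus Literature.Analysis.FluidPDE.LatticeShear
open Summit.AnomalousDissipation.AnomalousDissipation.Theorems.SolenoidalFractalHomogenisation.LagrangianStep.CellChain
  (linkCoeff modeRepθ rdot_modeRepθ hasDerivAt_modeRepθ)

variable {k₀ : ℕ}

/-! ## §1 Bookkeeping on the class lattice (twisted projections) -/

/-- **The representative is transversal at its own mode on `[0,T]`**: `P_k (modeRep k t) = modeRep k t`. [cite: Temam1984, Ch. III §1.1] -/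
theorem transversalProjR_modeRepθ (W₁ : LatticeWord k₀) (n : ℕ) {T : ℝ} (hT : 0 ≤ T) {𝔹 : Torus.Visc4 (Fin 3)} {G₀ : Matrix (Fin 3) (Fin 3) ℝ}
    {F : UnitAddTorus (Fin 3) → EuclideanSpace ℝ (Fin 3)} {u : ℝ → UnitAddTorus (Fin 3) → EuclideanSpace ℝ (Fin 3)}
    (h : Torus.IsWeakTensorPassiveVectorDistortedOn 0 T 𝔹 (W₁.cell n) (fun _ _ => G₀) F u) (k : Fin 3 → ℤ) {t : ℝ} (ht : t ∈ Icc 0 T) :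
    transversalProjR (twistFreq G₀ k) (modeRepθ W₁ n 𝔹 G₀ F u k t) = modeRepθ W₁ n 𝔹 G₀ F u k t :=
  transversalProjR_eq_self_of_rdot_eq_zero _ (rdot_modeRepθ W₁ n hT h k ht)

/-- **The neighbour split**: for every class point `w`, with `Z = sbVec … t` and `x = modeRep ℓ t`,
`modeRep(k_w, t) = P_{k_w}(coordL_w Z) + [w = 0]·x + [w ∉ box R, w ≠ 0]·modeRep(k_w, t)` (the three cases are exclusive and exhaustive;
the box part is transversal, `coordL` vanishes off the box). [cite: MajdaKramer1999, §2.2.1.3] -/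
theorem neighbour_split_frame (W₁ : LatticeWord k₀) (n : ℕ) {T : ℝ} (hT : 0 ≤ T) {𝔹 : Torus.Visc4 (Fin 3)} {G₀ : Matrix (Fin 3) (Fin 3) ℝ}
    {F : UnitAddTorus (Fin 3) → EuclideanSpace ℝ (Fin 3)} {u : ℝ → UnitAddTorus (Fin 3) → EuclideanSpace ℝ (Fin 3)}
    (h : Torus.IsWeakTensorPassiveVectorDistortedOn 0 T 𝔹 (W₁.cell n) (fun _ _ => G₀) F u) (ℓ : Fin 3 → ℤ) (R : ℕ) {t : ℝ} (ht : t ∈ Icc 0 T) (w : Fin 3 → ℤ) :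
    open Classical in
    modeRepθ W₁ n 𝔹 G₀ F u (classFreq n ℓ w) t =
      transversalProjR (twistFreq G₀ (classFreq n ℓ w)) (coordL R w (sbVecθ W₁ n 𝔹 G₀ F u ℓ R t)) +
      (if w = 0 then modeRepθ W₁ n 𝔹 G₀ F u ℓ t else 0) +
      (if (w ∉ box R ∧ w ≠ 0) then modeRepθ W₁ n 𝔹 G₀ F u (classFreq n ℓ w) t else 0) := by
  classical
  by_cases hw : w ∈ box R
  · have hw0 : w ≠ 0 := ne_zero_of_mem_box hw
    have hno : ¬ (w ∉ box R ∧ w ≠ 0) := fun hc => hc.1 hw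
    rw [if_neg hw0, if_neg hno, add_zero, add_zero, coordL_apply_of_mem hw, sbVecθ_apply, transversalProjR_modeRepθ W₁ n hT h _ ht]
  · rw [coordL_apply_of_not_mem hw, map_zero, zero_add]
    by_cases hw0 : w = 0
    · have hno : ¬ (w ∉ box R ∧ w ≠ 0) := fun hc => hc.2 hw0
      rw [if_pos hw0, if_neg hno, add_zero, hw0, classFreq_zero]
    · rw [if_neg hw0, if_pos ⟨hw, hw0⟩, zero_add]

/-! ## §2 The box-truncated twisted chain decomposes as `genXθ·Z + Σ ξⱼ sourceXθⱼ·x + tail` -/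

/-- **THE DECOMPOSITION of the representative right-hand side at a class frequency**: for `z ∈ box R` and `t ∈ [0,T]`,
`−4π² P_{k_z} T_{𝔹ᵀ}(k_z) y_{k_z} − Σⱼ linkCoeffⱼ(k_z,t) • P_{k_z}(αⱼ y_{k_z−Kⱼ} + ᾱⱼ y_{k_z+Kⱼ}) = (genX Z + Σⱼ ξⱼ • sourceXⱼ x + tailVec)_z`
(`y_κ = modeRep κ t`, `Z = sbVec … t`, `x = y_ℓ`; every augmentation `γ₁`, since `Z` is class-transversal).
[cite: MajdaKramer1999, §2.2.1.3 (cell problem (49))] [cite: MeshalkinSinai1961, pp. 1700–1705] -/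
theorem repRHSθ_classFreq_eq (W₁ : LatticeWord k₀) (n : ℕ) {T : ℝ} (hT : 0 ≤ T) {𝔹 : Torus.Visc4 (Fin 3)} {G₀ : Matrix (Fin 3) (Fin 3) ℝ}
    {F : UnitAddTorus (Fin 3) → EuclideanSpace ℝ (Fin 3)} {u : ℝ → UnitAddTorus (Fin 3) → EuclideanSpace ℝ (Fin 3)}
    (h : Torus.IsWeakTensorPassiveVectorDistortedOn 0 T 𝔹 (W₁.cell n) (fun _ _ => G₀) F u) (ℓ : Fin 3 → ℤ) (γ₁ : ℝ) (R : ℕ) {t : ℝ} (ht : t ∈ Icc 0 T) (z : box R) :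
    (-(((4 * Real.pi ^ 2 : ℝ) : ℂ) • transversalProjR (twistFreq G₀ (classFreq n ℓ z.1))
        (Torus.symbT (Torus.majorTranspose (Torus.Visc4.conj G₀ 𝔹)) (classFreq n ℓ z.1) (modeRepθ W₁ n 𝔹 G₀ F u (classFreq n ℓ z.1) t))) -
      ∑ j, linkCoeff W₁ n (classFreq n ℓ z.1) j t • transversalProjR (twistFreq G₀ (classFreq n ℓ z.1))
        ((Complex.exp ((W₁.phase j).φ * Complex.I) * (1 / (2 * ((2 * Real.pi * ‖latticeVec (W₁.phase j).m‖ : ℝ) : ℂ) * Complex.I))) •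
            modeRepθ W₁ n 𝔹 G₀ F u (classFreq n ℓ z.1 - fun i => (W₁.phase j).m i * n) t +
          (starRingEnd ℂ (Complex.exp ((W₁.phase j).φ * Complex.I)) *
              (-(1 / (2 * ((2 * Real.pi * ‖latticeVec (W₁.phase j).m‖ : ℝ) : ℂ) * Complex.I)))) •
            modeRepθ W₁ n 𝔹 G₀ F u (classFreq n ℓ z.1 + fun i => (W₁.phase j).m i * n) t))
    = genXθ W₁ n ℓ 𝔹 G₀ γ₁ R t (sbVecθ W₁ n 𝔹 G₀ F u ℓ R t) z +
      (∑ j, ((xiCoeff W₁ n ℓ j : ℝ) : ℂ) • sourceXθ W₁ n ℓ G₀ R j t (modeRepθ W₁ n 𝔹 G₀ F u ℓ t)) z +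
      tailVecθ W₁ n 𝔹 G₀ F u ℓ R t z := by
  classical
  -- names
  set Z := sbVecθ W₁ n 𝔹 G₀ F u ℓ R t with hZ
  set x := modeRepθ W₁ n 𝔹 G₀ F u ℓ t with hx
  have hslot : ∀ j, Complex.exp ((W₁.phase j).φ * Complex.I) * (1 / (2 * ((2 * Real.pi * ‖latticeVec (W₁.phase j).m‖ : ℝ) : ℂ) * Complex.I))
      = slotAmp W₁ j := fun j => (slotAmp_def W₁ j).symm
  have hslot' : ∀ j, starRingEnd ℂ (Complex.exp ((W₁.phase j).φ * Complex.I)) *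
      (-(1 / (2 * ((2 * Real.pi * ‖latticeVec (W₁.phase j).m‖ : ℝ) : ℂ) * Complex.I))) = starRingEnd ℂ (slotAmp W₁ j) :=
    fun j => (conj_slotAmp W₁ j).symm
  -- neighbours as class points
  have hsub : ∀ j, (classFreq n ℓ z.1 - fun i => (W₁.phase j).m i * n) = classFreq n ℓ (z.1 - (W₁.phase j).m) :=
    fun j => (classFreq_sub n ℓ z.1 (W₁.phase j).m).symm
  have hadd : ∀ j, (classFreq n ℓ z.1 + fun i => (W₁.phase j).m i * n) = classFreq n ℓ (z.1 + (W₁.phase j).m) :=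
    fun j => (classFreq_add n ℓ z.1 (W₁.phase j).m).symm
  simp_rw [hslot, hslot', hsub, hadd]
  obtain ⟨k, hk⟩ : ∃ k : Fin 3 → ℤ, k = classFreq n ℓ z.1 := ⟨_, rfl⟩
  -- the own mode
  have hownZ : coordL R z.1 Z = modeRepθ W₁ n 𝔹 G₀ F u k t := by
    rw [coordL_apply_of_mem z.2, hZ, sbVecθ_apply, hk]
  -- genX component
  rw [genXθ_apply, genXCompθ_apply, tailVecθ_apply, ← hk, hownZ, transversalProjR_modeRepθ W₁ n hT h _ ht, sub_self, smul_zero, sub_zero]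
  -- source component
  have hsrc : (∑ j, ((xiCoeff W₁ n ℓ j : ℝ) : ℂ) • sourceXθ W₁ n ℓ G₀ R j t x) z =
      ∑ j, ((xiCoeff W₁ n ℓ j : ℝ) : ℂ) • sourceXCompθ W₁ n ℓ G₀ R j t z x := by
    rw [space_sum_apply]
    refine Finset.sum_congr rfl fun j _ => ?_
    rw [PiLp.smul_apply, sourceXθ_apply]
  rw [hsrc]
  -- split every neighbour
  have hnb : ∀ j, modeRepθ W₁ n 𝔹 G₀ F u (classFreq n ℓ (z.1 - (W₁.phase j).m)) t =
      transversalProjR (twistFreq G₀ (classFreq n ℓ (z.1 - (W₁.phase j).m))) (coordL R (z.1 - (W₁.phase j).m) Z) +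
      (if z.1 - (W₁.phase j).m = 0 then x else 0) +
      (if (z.1 - (W₁.phase j).m ∉ box R ∧ z.1 - (W₁.phase j).m ≠ 0) then modeRepθ W₁ n 𝔹 G₀ F u (classFreq n ℓ (z.1 - (W₁.phase j).m)) t
        else 0) := fun j => neighbour_split_frame W₁ n hT h ℓ R ht _
  have hnb' : ∀ j, modeRepθ W₁ n 𝔹 G₀ F u (classFreq n ℓ (z.1 + (W₁.phase j).m)) t =
      transversalProjR (twistFreq G₀ (classFreq n ℓ (z.1 + (W₁.phase j).m))) (coordL R (z.1 + (W₁.phase j).m) Z) +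
      (if z.1 + (W₁.phase j).m = 0 then x else 0) +
      (if (z.1 + (W₁.phase j).m ∉ box R ∧ z.1 + (W₁.phase j).m ≠ 0) then modeRepθ W₁ n 𝔹 G₀ F u (classFreq n ℓ (z.1 + (W₁.phase j).m)) t
        else 0) := fun j => neighbour_split_frame W₁ n hT h ℓ R ht _
  -- the per-slot identity
  have hj : ∀ j, linkCoeff W₁ n k j t • transversalProjR (twistFreq G₀ k)
        (slotAmp W₁ j • modeRepθ W₁ n 𝔹 G₀ F u (classFreq n ℓ (z.1 - (W₁.phase j).m)) t +
          starRingEnd ℂ (slotAmp W₁ j) • modeRepθ W₁ n 𝔹 G₀ F u (classFreq n ℓ (z.1 + (W₁.phase j).m)) t)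
      = linkCoeff W₁ n k j t • transversalProjR (twistFreq G₀ k)
          (slotAmp W₁ j • transversalProjR (twistFreq G₀ (classFreq n ℓ (z.1 - (W₁.phase j).m))) (coordL R (z.1 - (W₁.phase j).m) Z) +
            starRingEnd ℂ (slotAmp W₁ j) • transversalProjR (twistFreq G₀ (classFreq n ℓ (z.1 + (W₁.phase j).m))) (coordL R (z.1 + (W₁.phase j).m) Z))
        - ((xiCoeff W₁ n ℓ j : ℝ) : ℂ) • sourceXCompθ W₁ n ℓ G₀ R j t z x
        + linkCoeff W₁ n k j t • transversalProjR (twistFreq G₀ k)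
          (slotAmp W₁ j • (if (z.1 - (W₁.phase j).m ∉ box R ∧ z.1 - (W₁.phase j).m ≠ 0) then
              modeRepθ W₁ n 𝔹 G₀ F u (classFreq n ℓ (z.1 - (W₁.phase j).m)) t else 0) +
            starRingEnd ℂ (slotAmp W₁ j) • (if (z.1 + (W₁.phase j).m ∉ box R ∧ z.1 + (W₁.phase j).m ≠ 0) then
              modeRepθ W₁ n 𝔹 G₀ F u (classFreq n ℓ (z.1 + (W₁.phase j).m)) t else 0)) := by
    intro j
    -- the slow part is the source
    have hsrcj : ((xiCoeff W₁ n ℓ j : ℝ) : ℂ) • sourceXCompθ W₁ n ℓ G₀ R j t z x =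
        -(linkCoeff W₁ n k j t • transversalProjR (twistFreq G₀ k)
          (slotAmp W₁ j • (if z.1 - (W₁.phase j).m = 0 then x else 0) +
            starRingEnd ℂ (slotAmp W₁ j) • (if z.1 + (W₁.phase j).m = 0 then x else 0))) := by
      rw [sourceXCompθ, add_apply]
      by_cases h1 : z.1 = (W₁.phase j).m
      · have h1' : z.1 - (W₁.phase j).m = 0 := by rw [h1, sub_self]
        have h2 : ¬ z.1 = -(W₁.phase j).m := by
          intro hc
          have : (W₁.phase j).m = 0 := by
            have e : (W₁.phase j).m = -(W₁.phase j).m := h1.symm.trans hc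
            funext i; have := congrFun e i; simp only [Pi.neg_apply] at this; simp only [Pi.zero_apply]; omega
          exact (W₁.phase j).m_ne this
        have h2' : ¬ z.1 + (W₁.phase j).m = 0 := fun hc => h2 (eq_neg_of_add_eq_zero_left hc)
        have hlc : linkCoeff W₁ n k j t = linkCoeff W₁ n ℓ j t := by
          rw [hk, h1]; exact linkCoeff_classFreq_self W₁ n ℓ j t
        rw [if_pos h1', if_neg h2', if_pos h1, if_neg h2, smul_zero, add_zero, zero_apply, add_zero, smul_apply, hlc,
          linkCoeff_slow_eq, map_smul, smul_smul, smul_smul, ← neg_smul, hk]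
        congr 1; ring
      · have h1' : ¬ z.1 - (W₁.phase j).m = 0 := fun hc => h1 (sub_eq_zero.1 hc)
        by_cases h2 : z.1 = -(W₁.phase j).m
        · have h2' : z.1 + (W₁.phase j).m = 0 := by rw [h2, neg_add_cancel]
          have hlc : linkCoeff W₁ n k j t = linkCoeff W₁ n ℓ j t := by
            rw [hk, h2]; exact linkCoeff_classFreq_neg_self W₁ n ℓ j t
          rw [if_neg h1', if_pos h2', if_neg h1, if_pos h2, smul_zero, zero_add, zero_apply, zero_add, smul_apply, hlc,
            linkCoeff_slow_eq, map_smul, smul_smul, smul_smul, ← neg_smul, hk]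
          congr 1; ring
        · have h2' : ¬ z.1 + (W₁.phase j).m = 0 := fun hc => h2 (eq_neg_of_add_eq_zero_left hc)
          rw [if_neg h1', if_neg h2', if_neg h1, if_neg h2]
          simp
    conv_lhs => rw [hnb j, hnb' j]
    rw [hsrcj]
    exact link_split_identity _ _ _ _ _ _ _ _ _ _
  -- assemble
  rw [Finset.sum_congr rfl fun j _ => hj j, Finset.sum_add_distrib, Finset.sum_sub_distrib]
  exact rhs_assemble_identity _ _ _ _

/-! ## §3 The box vector and the slow mode are classical solutions on `(0,T)` -/

/-- **The box-truncated sideband vector of THE weak solution is a classical solution of the finite-ξ truncated system** on `(0,T)`: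
`HasDerivAt Z (genX t Z + Σⱼ ξⱼ • sourceXⱼ t x + tailVec t) t`. [cite: Temam1984, Ch. III §1.1] [cite: MajdaKramer1999, §2.2.1.3] -/
theorem hasDerivAt_sbVecθ (W₁ : LatticeWord k₀) (n : ℕ) {T : ℝ} {𝔹 : Torus.Visc4 (Fin 3)} {G₀ : Matrix (Fin 3) (Fin 3) ℝ}
    {F : UnitAddTorus (Fin 3) → EuclideanSpace ℝ (Fin 3)} {u : ℝ → UnitAddTorus (Fin 3) → EuclideanSpace ℝ (Fin 3)}
    (h : Torus.IsWeakTensorPassiveVectorDistortedOn 0 T 𝔹 (W₁.cell n) (fun _ _ => G₀) F u) (hF : Integrable F volume) (ℓ : Fin 3 → ℤ) (γ₁ : ℝ) (R : ℕ)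
    {t : ℝ} (ht : t ∈ Ioo 0 T) :
    HasDerivAt (sbVecθ W₁ n 𝔹 G₀ F u ℓ R)
      (genXθ W₁ n ℓ 𝔹 G₀ γ₁ R t (sbVecθ W₁ n 𝔹 G₀ F u ℓ R t) +
        ∑ j, ((xiCoeff W₁ n ℓ j : ℝ) : ℂ) • sourceXθ W₁ n ℓ G₀ R j t (modeRepθ W₁ n 𝔹 G₀ F u ℓ t) +
        tailVecθ W₁ n 𝔹 G₀ F u ℓ R t) t := by
  have hT : 0 ≤ T := (ht.1.trans ht.2).le
  have ht' : t ∈ Icc 0 T := Ioo_subset_Icc_self ht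
  -- componentwise derivative
  have hpi : HasDerivAt (fun s => fun z : box R => modeRepθ W₁ n 𝔹 G₀ F u (classFreq n ℓ z.1) s)
      (fun z : box R =>
        (-(((4 * Real.pi ^ 2 : ℝ) : ℂ) • transversalProjR (twistFreq G₀ (classFreq n ℓ z.1))
          (Torus.symbT (Torus.majorTranspose (Torus.Visc4.conj G₀ 𝔹)) (classFreq n ℓ z.1) (modeRepθ W₁ n 𝔹 G₀ F u (classFreq n ℓ z.1) t))) -
        ∑ j, linkCoeff W₁ n (classFreq n ℓ z.1) j t • transversalProjR (twistFreq G₀ (classFreq n ℓ z.1))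
          ((Complex.exp ((W₁.phase j).φ * Complex.I) * (1 / (2 * ((2 * Real.pi * ‖latticeVec (W₁.phase j).m‖ : ℝ) : ℂ) * Complex.I))) •
              modeRepθ W₁ n 𝔹 G₀ F u (classFreq n ℓ z.1 - fun i => (W₁.phase j).m i * n) t +
            (starRingEnd ℂ (Complex.exp ((W₁.phase j).φ * Complex.I)) *
                (-(1 / (2 * ((2 * Real.pi * ‖latticeVec (W₁.phase j).m‖ : ℝ) : ℂ) * Complex.I)))) •
              modeRepθ W₁ n 𝔹 G₀ F u (classFreq n ℓ z.1 + fun i => (W₁.phase j).m i * n) t))) t :=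
    hasDerivAt_pi.2 fun z => hasDerivAt_modeRepθ W₁ n h hF (classFreq n ℓ z.1) ht
  have hL := ((PiLp.continuousLinearEquiv 2 ℝ (fun _ : box R => EuclideanSpace ℂ (Fin 3))).symm :
    (box R → EuclideanSpace ℂ (Fin 3)) →L[ℝ] Space R).hasFDerivAt.comp_hasDerivAt t hpi
  have hval : ((PiLp.continuousLinearEquiv 2 ℝ (fun _ : box R => EuclideanSpace ℂ (Fin 3))).symm :
      (box R → EuclideanSpace ℂ (Fin 3)) →L[ℝ] Space R) (fun z : box R =>
        (-(((4 * Real.pi ^ 2 : ℝ) : ℂ) • transversalProjR (twistFreq G₀ (classFreq n ℓ z.1))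
          (Torus.symbT (Torus.majorTranspose (Torus.Visc4.conj G₀ 𝔹)) (classFreq n ℓ z.1) (modeRepθ W₁ n 𝔹 G₀ F u (classFreq n ℓ z.1) t))) -
        ∑ j, linkCoeff W₁ n (classFreq n ℓ z.1) j t • transversalProjR (twistFreq G₀ (classFreq n ℓ z.1))
          ((Complex.exp ((W₁.phase j).φ * Complex.I) * (1 / (2 * ((2 * Real.pi * ‖latticeVec (W₁.phase j).m‖ : ℝ) : ℂ) * Complex.I))) •
              modeRepθ W₁ n 𝔹 G₀ F u (classFreq n ℓ z.1 - fun i => (W₁.phase j).m i * n) t +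
            (starRingEnd ℂ (Complex.exp ((W₁.phase j).φ * Complex.I)) *
                (-(1 / (2 * ((2 * Real.pi * ‖latticeVec (W₁.phase j).m‖ : ℝ) : ℂ) * Complex.I)))) •
              modeRepθ W₁ n 𝔹 G₀ F u (classFreq n ℓ z.1 + fun i => (W₁.phase j).m i * n) t)))
      = genXθ W₁ n ℓ 𝔹 G₀ γ₁ R t (sbVecθ W₁ n 𝔹 G₀ F u ℓ R t) +
        ∑ j, ((xiCoeff W₁ n ℓ j : ℝ) : ℂ) • sourceXθ W₁ n ℓ G₀ R j t (modeRepθ W₁ n 𝔹 G₀ F u ℓ t) +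
        tailVecθ W₁ n 𝔹 G₀ F u ℓ R t := by
    apply PiLp.ext
    intro z
    rw [PiLp.add_apply, PiLp.add_apply, ← repRHSθ_classFreq_eq W₁ n hT h ℓ γ₁ R ht' z]
    rfl
  rw [hval] at hL
  exact hL

/-- **The slow mode is driven by the box vector through the ξ = 0 feedback functionals**: on `(0,T)`, if every `mⱼ` is retained,
`HasDerivAt (modeRep … ℓ) (−4π² P_ℓ T_{𝔹ᵀ}(ℓ) x − Σⱼ ξⱼ • P_ℓ (feedbackⱼ t Z)) t`. [cite: Temam1984, Ch. III §1.1] [cite: MajdaKramer1999, §2.2.1.3 (55)] -/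
theorem hasDerivAt_slowRepθ (W₁ : LatticeWord k₀) (n : ℕ) {T : ℝ} {𝔹 : Torus.Visc4 (Fin 3)} {G₀ : Matrix (Fin 3) (Fin 3) ℝ}
    {F : UnitAddTorus (Fin 3) → EuclideanSpace ℝ (Fin 3)} {u : ℝ → UnitAddTorus (Fin 3) → EuclideanSpace ℝ (Fin 3)}
    (h : Torus.IsWeakTensorPassiveVectorDistortedOn 0 T 𝔹 (W₁.cell n) (fun _ _ => G₀) F u) (hF : Integrable F volume) (ℓ : Fin 3 → ℤ) {R : ℕ}
    (hbox : ∀ j, (W₁.phase j).m ∈ box R) {t : ℝ} (ht : t ∈ Ioo 0 T) :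
    HasDerivAt (modeRepθ W₁ n 𝔹 G₀ F u ℓ)
      (-(((4 * Real.pi ^ 2 : ℝ) : ℂ) • transversalProjR (twistFreq G₀ ℓ) (Torus.symbT (Torus.majorTranspose (Torus.Visc4.conj G₀ 𝔹)) ℓ (modeRepθ W₁ n 𝔹 G₀ F u ℓ t))) -
        ∑ j, ((xiCoeff W₁ n ℓ j : ℝ) : ℂ) • transversalProjR (twistFreq G₀ ℓ) (feedback W₁ R j t (sbVecθ W₁ n 𝔹 G₀ F u ℓ R t))) t := by
  have hd := hasDerivAt_modeRepθ W₁ n h hF ℓ ht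
  refine hd.congr_deriv ?_
  congr 1
  refine Finset.sum_congr rfl fun j _ => ?_
  have hneg : -(W₁.phase j).m ∈ box R := by
    have hm := mem_box.1 (hbox j)
    refine mem_box.2 ⟨fun i => ?_, neg_ne_zero.2 hm.2⟩
    have := hm.1 i
    simp only [Pi.neg_apply]
    omega
  have hsub : (ℓ - fun i => (W₁.phase j).m i * n) = classFreq n ℓ (-(W₁.phase j).m) := by
    have := classFreq_sub n ℓ 0 (W₁.phase j).m
    rw [zero_sub, classFreq_zero] at this
    exact this.symm
  have hadd : (ℓ + fun i => (W₁.phase j).m i * n) = classFreq n ℓ (W₁.phase j).m := by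
    have := classFreq_add n ℓ 0 (W₁.phase j).m
    rw [zero_add, classFreq_zero] at this
    exact this.symm
  rw [hsub, hadd, ← slotAmp_def, ← conj_slotAmp, feedback, smul_apply, add_apply, smul_apply, smul_apply, coordL_apply_of_mem hneg,
    coordL_apply_of_mem (hbox j),
    sbVecθ_apply, sbVecθ_apply, linkCoeff_slow_eq, map_smul, smul_smul]

end Summit.AnomalousDissipation.AnomalousDissipation.Theorems.SolenoidalFractalHomogenisation.LagrangianStep.Sideband

end
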